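import Literature.MathematicalPhysics.QuantumLattice.Phi4VolumeMonotonicity
import Literature.MathematicalPhysics.QuantumLattice.Phi4MessagerMiracleSole
import Literature.Probability.LatticeModels.MessagerMiracleSole
import Literature.Probability.LatticeModels.SharpnessProofs
import HarnessLib

/-!
# Messager–Miracle-Solé monotonicity of the infinite-volume lattice `φ⁴` two-point function on `ℤᵈ`

Proofs-only file (topic `Literature/MathematicalPhysics/QuantumLattice`; theorems only, no definition,
no named fact). Fifth step of the `φ⁴` line of Aizenman–Duminil-Copin 2021 in the tree's vocabulary:
**§5.1, Prop. 5.1 (MMS monotonicity) and its consequence (5.21)** for the free-boundary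
infinite-volume two-point function of the nearest-neighbour lattice `φ⁴` model on `ℤᵈ`,
`S(x) = ⨆_Λ ⟨φ₀ φₓ⟩_{Λ; g,κ,J}` (`= phi4TwoPoint d g κ J x`, `Phi4VolumeMonotonicity`), for every
`g > 0`, `κ ∈ ℝ`, `J ≥ 0`:

* `iSup_phi4TwoPointIn_map_iso`, `iSup_phi4TwoPointIn_signedPerm` — invariance of the
  infinite-volume two-point function under the automorphisms of `ℤᵈ` (signed coordinate
  permutations);
* `phi4TwoPointIn_reflect_le`, `iSup_phi4TwoPointIn_reflect_le` — the Messager–Miracle-Solé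
  inequality `S(a, θb) ≤ S(a, b)` for a reflection `θ` of `ℤᵈ` and `a, b` on its positive side,
  in the `θ`-symmetric finite volumes (from `phi4_twoPoint_reflect_le`, `Phi4MessagerMiracleSole`)
  and in infinite volume along the symmetrised boxes `Λ(L) ∪ θΛ(L)`;
* `phi4_mms_axis`, `phi4_mms_diag` — the two elementary moves: `S(x + eᵢ) ≤ S(x)` for `xᵢ ≥ 0`
  (reflection in `{yᵢ = xᵢ + ½}`; Hegerfeldt 1977, Thm 3.1 (3.8)) and `S(x + eᵢ - eⱼ) ≤ S(x)` for
  `xⱼ ≤ xᵢ` (reflection in the diagonal hyperplane `{yᵢ - yⱼ = xᵢ - xⱼ + 1}`; ibid. Thm 3.2 (3.10));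
* an **abstract combinatorial section** (`MonotoneWalk`): for any function `T` on `ℤᵈ` invariant
  under signed permutations and decreasing under the two moves, `T(y) ≤ T(n e₁)` and
  `T(d n e₁) ≤ T(y)` for `‖y‖_∞ = n` (the two halves of Duminil-Copin 2019, eq. (4.10), here
  abstracted from the tree's `MessagerMiracleSoleFree`, whose proofs are followed line by line), and
  hence ADC's (5.21): `T(y) ≤ T(x)` whenever `‖y‖_∞ ≥ d ‖x‖_∞`;
* `phi4_iSup_le_of_supNorm_le` — **(5.21) for lattice `φ⁴`**: `S(y) ≤ S(x)` for
  `‖y‖_∞ ≥ d‖x‖_∞` (Aizenman–Duminil-Copin 2021, (5.21), p. 16).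

## References

* M. Aizenman, H. Duminil-Copin, Ann. of Math. 194 (2021), arXiv:1912.07973, §5.1: (5.1),
  Prop. 5.1, (5.21) (p. 16) [AizenmanDuminilCopinAnnals2021].
* A. Messager, S. Miracle-Solé, J. Stat. Phys. 17 (1977) 245–262 [MessagerMiracleSoleJSP1977].
* G. C. Hegerfeldt, Comm. Math. Phys. 57 (1977) 259–266, Thm 3.1 (3.8), Thm 3.2 (3.10)
  [Hegerfeldt1977].
* H. Duminil-Copin, *Lectures on the Ising and Potts models* (2019), §4.3, Exercise 37, eq. (4.10)
  [DuminilCopin2019] — the combinatorial walk, as formalised for the Ising free state in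
  `Literature/Probability/LatticeModels/MessagerMiracleSoleFree.lean`.
-/

noncomputable section

open MeasureTheory Filter Topology Finset
open Literature.Probability.LatticeModels
open Literature.Probability (Percolation.zdSignedPermIso Percolation.zdSignedPermIso_apply)

namespace Literature.MathematicalPhysics.QuantumLattice

variable (d : ℕ)

/-! ### Invariance under the automorphisms of `ℤᵈ` -/

section Iso

/-- Relabelling a finite volume and the two sites by an automorphism of `ℤᵈ` does not change the
free-boundary two-point function. [folklore] -/
theorem phi4TwoPointIn_map_iso (θ : Site d ≃ Site d)
    (hadj : ∀ x y, (zdGraph d).Adj (θ x) (θ y) ↔ (zdGraph d).Adj x y) (Λ : Finset (Site d))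
    (g κ J : ℝ) (x y : Site d) :
    phi4TwoPointIn d (Λ.map θ.toEmbedding) g κ J (θ x) (θ y) = phi4TwoPointIn d Λ g κ J x y := by
  classical
  have hmem : ∀ z : Site d, θ z ∈ Λ.map θ.toEmbedding ↔ z ∈ Λ := by
    intro z
    rw [Finset.mem_map_equiv, Equiv.symm_apply_apply]
  by_cases hx : x ∈ Λ
  swap
  · rw [phi4TwoPointIn_eq_zero_of_not_mem d Λ g κ J (Or.inl hx),
      phi4TwoPointIn_eq_zero_of_not_mem d _ g κ J (Or.inl (mt (hmem x).1 hx))]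
  by_cases hy : y ∈ Λ
  swap
  · rw [phi4TwoPointIn_eq_zero_of_not_mem d Λ g κ J (Or.inr hy),
      phi4TwoPointIn_eq_zero_of_not_mem d _ g κ J (Or.inr (mt (hmem y).1 hy))]
  have hmem' : ∀ w : Site d, w ∈ Λ.map θ.toEmbedding → θ.symm w ∈ Λ := fun w hw =>
    (hmem _).1 (by rwa [Equiv.apply_symm_apply])
  let e : zdGraphIn d Λ ≃g zdGraphIn d (Λ.map θ.toEmbedding) :=
    { toFun := fun z => ⟨θ z, (hmem z).2 z.2⟩
      invFun := fun w => ⟨θ.symm w, hmem' w w.2⟩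
      left_inv := fun z => Subtype.ext (θ.symm_apply_apply (z : Site d))
      right_inv := fun w => Subtype.ext (θ.apply_symm_apply (w : Site d))
      map_rel_iff' := by
        intro z w
        change (zdGraph d).Adj (θ z) (θ w) ↔ (zdGraph d).Adj z w
        exact hadj z w }
  rw [phi4TwoPointIn_eq_of_mem d Λ g κ J hx hy,
    phi4TwoPointIn_eq_of_mem d _ g κ J ((hmem x).2 hx) ((hmem y).2 hy),
    ← phi4_twoPoint_iso _ _ e g κ J ⟨x, hx⟩ ⟨y, hy⟩]
  rfl

/-- **Invariance of the infinite-volume two-point function under the automorphisms of `ℤᵈ`**: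
`⨆_Λ ⟨φ_{θx} φ_{θy}⟩_Λ = ⨆_Λ ⟨φₓ φ_y⟩_Λ`. [cite: FriedliVelenik2017, Exercise 3.14, p. 115] -/
theorem iSup_phi4TwoPointIn_map_iso (θ : Site d ≃ Site d)
    (hadj : ∀ x y, (zdGraph d).Adj (θ x) (θ y) ↔ (zdGraph d).Adj x y) (g κ J : ℝ)
    (x y : Site d) :
    (⨆ Λ : Finset (Site d), phi4TwoPointIn d Λ g κ J (θ x) (θ y)) =
      ⨆ Λ : Finset (Site d), phi4TwoPointIn d Λ g κ J x y := by
  have hsurj : Function.Surjective fun Λ : Finset (Site d) => Λ.map θ.toEmbedding := by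
    intro Λ'
    refine ⟨Λ'.map θ.symm.toEmbedding, ?_⟩
    ext z
    simp only [Finset.map_map, Finset.mem_map, Function.Embedding.trans_apply,
      Equiv.coe_toEmbedding, Equiv.apply_symm_apply]
    constructor
    · rintro ⟨a, ha, rfl⟩
      exact ha
    · intro hz
      exact ⟨z, hz, rfl⟩
  rw [← hsurj.iSup_comp (fun Λ => phi4TwoPointIn d Λ g κ J (θ x) (θ y))]
  simp only [phi4TwoPointIn_map_iso d θ hadj]

/-- **Invariance of `S(x) = ⨆_Λ ⟨φ₀ φₓ⟩_Λ` under signed coordinate permutations** (the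
hyperoctahedral symmetries of `ℤᵈ`, which fix the origin). [cite: FriedliVelenik2017, Exercise 3.14, p. 115] -/
theorem iSup_phi4TwoPointIn_signedPerm (π : Equiv.Perm (Fin d)) (ε : Fin d → ℤˣ) (g κ J : ℝ)
    (x : Site d) :
    (⨆ Λ : Finset (Site d), phi4TwoPointIn d Λ g κ J 0 (Site.signedPerm π ε x)) =
      ⨆ Λ : Finset (Site d), phi4TwoPointIn d Λ g κ J 0 x := by
  have hadj : ∀ a b, (zdGraph d).Adj (Site.signedPerm π ε a) (Site.signedPerm π ε b) ↔
      (zdGraph d).Adj a b := fun a b => (Percolation.zdSignedPermIso π ε).map_rel_iff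
  have h := iSup_phi4TwoPointIn_map_iso d (Site.signedPerm π ε) hadj g κ J 0 x
  rwa [Site.signedPerm_zero] at h

end Iso

/-! ### The Messager–Miracle-Solé inequality on `ℤᵈ` -/

section Reflect

/-- **Messager–Miracle-Solé in a `θ`-symmetric finite volume of `ℤᵈ`** (from
`phi4_twoPoint_reflect_le` by restricting the reflection to the volume): for an involutive
automorphism `θ` of `ℤᵈ`, a positive side `P` with `θ(P) ∩ P = ∅`, all sites off `P ∪ θ(P)` fixed
and no bond from `P` to `θ(P)` other than the bonds `{x, θx}`, a `θ`-stable volume `Λ`, `g > 0`,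
`J ≥ 0` and `a, b ∈ Λ ∩ P`: `⟨φ_a φ_{θb}⟩_Λ ≤ ⟨φ_a φ_b⟩_Λ`. [cite: AizenmanDuminilCopinAnnals2021, §5.1, display (5.1) (p. 16)] [cite: MessagerMiracleSoleJSP1977, main theorem] -/
theorem phi4TwoPointIn_reflect_le (θ : Site d ≃ Site d) (hθ : Function.Involutive θ)
    (hadj : ∀ x y, (zdGraph d).Adj (θ x) (θ y) ↔ (zdGraph d).Adj x y)
    (P : Site d → Prop) [DecidablePred P] (hPθ : ∀ x, P x → ¬P (θ x))
    (hfix : ∀ x, ¬P x → ¬P (θ x) → θ x = x)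
    (hedge : ∀ x y, (zdGraph d).Adj x y → P x → ¬P y → θ y ≠ y → y = θ x)
    {Λ : Finset (Site d)} (hΛ : ∀ x, x ∈ Λ ↔ θ x ∈ Λ) {g : ℝ} (hg : 0 < g) (κ : ℝ) {J : ℝ}
    (hJ : 0 ≤ J) {a b : Site d} (ha : a ∈ Λ) (hb : b ∈ Λ) (hPa : P a) (hPb : P b) :
    phi4TwoPointIn d Λ g κ J a (θ b) ≤ phi4TwoPointIn d Λ g κ J a b := by
  classical
  let θV : Equiv.Perm Λ := θ.subtypeEquiv fun x => hΛ x
  let PV : Finset Λ := Finset.univ.filter fun z : Λ => P (z : Site d)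
  have hmemPV : ∀ z : Λ, z ∈ PV ↔ P (z : Site d) := fun z => by simp [PV]
  have hθV : ∀ u, θV (θV u) = u := fun u => Subtype.ext (hθ u)
  have hθV_coe : ∀ u : Λ, ((θV u : Λ) : Site d) = θ u := fun u => rfl
  have hPV : ∀ u ∈ PV, θV u ∉ PV := by
    intro u hu
    rw [hmemPV] at hu ⊢
    exact hPθ u hu
  have hcov : ∀ u : Λ, u ∈ PV ∨ θV u ∈ PV ∨ θV u = u := by
    intro u
    by_cases h1 : P (u : Site d)
    · exact Or.inl ((hmemPV u).2 h1)
    · by_cases h2 : P (θ u)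
      · exact Or.inr (Or.inl ((hmemPV _).2 h2))
      · exact Or.inr (Or.inr (Subtype.ext (hfix u h1 h2)))
  have hadjV : ∀ x y : Λ, (zdGraphIn d Λ).Adj (θV x) (θV y) ↔ (zdGraphIn d Λ).Adj x y :=
    fun x y => hadj x y
  have hedgeV : ∀ u ∈ PV, ∀ v ∈ PV, (zdGraphIn d Λ).Adj u (θV v) → u = v := by
    intro u hu v hv huv
    rw [hmemPV] at hu hv
    have h1 : θ (θ v) ≠ θ v := by
      rw [hθ v]
      exact fun h => hPθ v hv (h ▸ hv)
    have h2 := hedge u (θ v) huv hu (hPθ v hv) h1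
    exact (Subtype.ext (θ.injective h2)).symm
  have key := phi4_twoPoint_reflect_le θV PV (zdGraphIn d Λ) hθV hPV hcov hadjV hedgeV hg κ hJ
    (a := ⟨a, ha⟩) (b := ⟨b, hb⟩) (Or.inl ((hmemPV _).2 hPa)) ((hmemPV _).2 hPb)
  rw [phi4TwoPointIn_eq_of_mem d Λ g κ J ha ((hΛ b).1 hb), phi4TwoPointIn_eq_of_mem d Λ g κ J ha hb]
  exact key

/-- The symmetrised boxes `Λ(L) ∪ θΛ(L)` increase with `L`. [folklore] -/
theorem symBox_mono (θ : Site d ≃ Site d) : Monotone (symBox θ) := fun _ _ h =>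
  Finset.union_subset_union (box_mono d h) (Finset.map_subset_map.2 (box_mono d h))

/-- The free-boundary two-point functions along the symmetrised boxes converge to the
infinite-volume two-point function. [folklore] -/
theorem tendsto_phi4TwoPointIn_symBox (θ : Site d ≃ Site d) {g : ℝ} (hg : 0 < g) (κ : ℝ)
    {J : ℝ} (hJ : 0 ≤ J) (x y : Site d) :
    Tendsto (fun L => phi4TwoPointIn d (symBox θ L) g κ J x y) atTop
      (𝓝 (⨆ Λ : Finset (Site d), phi4TwoPointIn d Λ g κ J x y)) :=
  tendsto_phi4TwoPointIn_iSup d (symBox_mono d θ) (fun Λ => by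
    obtain ⟨R, hR⟩ := exists_box_supset d Λ
    exact ⟨R, hR.trans (box_subset_symBox θ R)⟩) hg κ hJ x y

/-- **Messager–Miracle-Solé for the infinite-volume `φ⁴` two-point function on `ℤᵈ`**: under the
hypotheses of `phi4TwoPointIn_reflect_le` on `θ` and `P`, for `g > 0`, `J ≥ 0` and `a, b ∈ P`,
`⨆_Λ ⟨φ_a φ_{θb}⟩_Λ ≤ ⨆_Λ ⟨φ_a φ_b⟩_Λ` (pass to the limit along `Λ(L) ∪ θΛ(L)`). [cite: AizenmanDuminilCopinAnnals2021, §5.1, (5.1) and "In the infinite volume limit on ℤ^d, this principle can be invoked for reflections …" (p. 16)] [cite: MessagerMiracleSoleJSP1977, main theorem] -/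
theorem iSup_phi4TwoPointIn_reflect_le (θ : Site d ≃ Site d) (hθ : Function.Involutive θ)
    (hadj : ∀ x y, (zdGraph d).Adj (θ x) (θ y) ↔ (zdGraph d).Adj x y)
    (P : Site d → Prop) [DecidablePred P] (hPθ : ∀ x, P x → ¬P (θ x))
    (hfix : ∀ x, ¬P x → ¬P (θ x) → θ x = x)
    (hedge : ∀ x y, (zdGraph d).Adj x y → P x → ¬P y → θ y ≠ y → y = θ x)
    {g : ℝ} (hg : 0 < g) (κ : ℝ) {J : ℝ} (hJ : 0 ≤ J) {a b : Site d} (hPa : P a) (hPb : P b) :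
    (⨆ Λ : Finset (Site d), phi4TwoPointIn d Λ g κ J a (θ b)) ≤
      ⨆ Λ : Finset (Site d), phi4TwoPointIn d Λ g κ J a b := by
  refine le_of_tendsto_of_tendsto (tendsto_phi4TwoPointIn_symBox d θ hg κ hJ a (θ b))
    (tendsto_phi4TwoPointIn_symBox d θ hg κ hJ a b) ?_
  obtain ⟨L₀, hL₀⟩ := exists_box_supset d ({a, b} : Finset (Site d))
  filter_upwards [eventually_ge_atTop L₀] with L hL
  have hsub : ({a, b} : Finset (Site d)) ⊆ symBox θ L :=
    hL₀.trans ((box_mono d hL).trans (box_subset_symBox θ L))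
  exact phi4TwoPointIn_reflect_le d θ hθ hadj P hPθ hfix hedge (fun x => mem_symBox_iff hθ x) hg κ
    hJ (hsub (Finset.mem_insert_self a {b}))
    (hsub (Finset.mem_insert_of_mem (Finset.mem_singleton_self b))) hPa hPb

/-- **The axis move** (Messager–Miracle-Solé / Hegerfeldt 1977, Thm 3.1 (3.8), for lattice `φ⁴`):
for `g > 0`, `J ≥ 0` and `xᵢ ≥ 0`, `S(x + eᵢ) ≤ S(x)` where `S(x) = ⨆_Λ ⟨φ₀φₓ⟩_Λ` — reflection of
`ℤᵈ` in the hyperplane `{yᵢ = xᵢ + ½}`, which exchanges `x` and `x + eᵢ` and has `0` and `x` on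
its positive side. [cite: Hegerfeldt1977, Thm. 3.1, eq. (3.8)] [cite: AizenmanDuminilCopinAnnals2021, Prop. 5.1 (i) (p. 16)] -/
theorem phi4_mms_axis {g : ℝ} (hg : 0 < g) (κ : ℝ) {J : ℝ} (hJ : 0 ≤ J) (x : Site d) (i : Fin d)
    (hxi : 0 ≤ x i) :
    (⨆ Λ : Finset (Site d), phi4TwoPointIn d Λ g κ J 0 (x + Pi.single i 1)) ≤
      ⨆ Λ : Finset (Site d), phi4TwoPointIn d Λ g κ J 0 x := by
  classical
  set k : ℤ := 2 * x i + 1 with hk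
  have hkodd : Odd k := ⟨x i, rfl⟩
  have hθx : axisRefl i k x = x + Pi.single i 1 := by
    funext j
    rw [axisRefl_apply, Pi.add_apply]
    by_cases hj : j = i
    · subst hj; simp; omega
    · simp [hj]
  rw [← hθx]
  refine iSup_phi4TwoPointIn_reflect_le d (axisRefl i k) (axisRefl_involutive i k)
    (zdGraph_adj_axisRefl i k) (fun y : Site d => 2 * y i < k) ?_ ?_ ?_ hg κ hJ (a := 0)
    (by show 2 * (0 : Site d) i < k; simp; omega) (by show 2 * x i < k; omega)
  · intro y hy
    simp only [axisRefl_apply, if_true, not_lt]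
    omega
  · intro y hy hθy
    simp only [axisRefl_apply, if_true, not_lt] at hy hθy
    exfalso
    obtain ⟨m, hm⟩ := hkodd
    omega
  · intro y z hyz hy hz _
    simp only [not_lt] at hz
    obtain ⟨l, hl, hrest⟩ := zdGraph_adj_coord hyz
    funext m
    rw [axisRefl_apply]
    by_cases hm : m = i
    · subst hm
      rw [if_pos rfl]
      by_cases hlm : l = m
      · subst hlm
        obtain ⟨n, hn⟩ := hkodd
        omega
      · have := hrest m (Ne.symm hlm)
        omega
    · rw [if_neg hm]
      by_cases hlm : l = m
      · subst hlm
        have := hrest i (Ne.symm hm)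
        omega
      · exact hrest m (Ne.symm hlm)

/-- **The diagonal move** (Messager–Miracle-Solé / Hegerfeldt 1977, Thm 3.2 (3.10), for lattice
`φ⁴`): for `g > 0`, `J ≥ 0`, `i ≠ j` and `xⱼ ≤ xᵢ`, `S(x + eᵢ - eⱼ) ≤ S(x)` — reflection in the
diagonal hyperplane `{yᵢ - yⱼ = xᵢ - xⱼ + 1}`. [cite: Hegerfeldt1977, Thm. 3.2, eq. (3.10)] [cite: AizenmanDuminilCopinAnnals2021, Prop. 5.1 (ii) (p. 16)] -/
theorem phi4_mms_diag {g : ℝ} (hg : 0 < g) (κ : ℝ) {J : ℝ} (hJ : 0 ≤ J) (x : Site d) {i j : Fin d}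
    (hij : i ≠ j) (hxji : x j ≤ x i) :
    (⨆ Λ : Finset (Site d), phi4TwoPointIn d Λ g κ J 0 (x + Pi.single i 1 - Pi.single j 1)) ≤
      ⨆ Λ : Finset (Site d), phi4TwoPointIn d Λ g κ J 0 x := by
  classical
  set c : ℤ := x i - x j + 1 with hc
  have hθx : diagRefl i j c x = x + Pi.single i 1 - Pi.single j 1 := by
    funext l
    rw [diagRefl_apply hij, Pi.sub_apply, Pi.add_apply]
    by_cases hli : l = i
    · subst hli; simp [hij]; omega
    · by_cases hlj : l = j
      · subst hlj; simp [hli]; omega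
      · simp [hli, hlj]
  rw [← hθx]
  refine iSup_phi4TwoPointIn_reflect_le d (diagRefl i j c) (diagRefl_involutive hij c)
    (zdGraph_adj_diagRefl i j c) (fun y : Site d => y i - y j < c) ?_ ?_ ?_ hg κ hJ (a := 0)
    (by show (0 : Site d) i - (0 : Site d) j < c; simp; omega) (by show x i - x j < c; omega)
  · intro y hy
    simp only [diagRefl_apply hij, if_true, if_neg hij.symm, not_lt]
    omega
  · intro y hy hθy
    simp only [diagRefl_apply hij, if_true, if_neg hij.symm, not_lt] at hy hθy
    have hyc : y i - y j = c := le_antisymm (by omega) hy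
    funext l
    rw [diagRefl_apply hij]
    split_ifs with h1 h2
    · subst h1; omega
    · subst h2; omega
    · rfl
  · intro y z hyz hy hz hθz
    exfalso
    apply hθz
    simp only [not_lt] at hz
    obtain ⟨l, hl, hrest⟩ := zdGraph_adj_coord hyz
    have hzc : z i - z j = c := by
      have h1 : z i - z j ≤ y i - y j + 1 := by
        by_cases hli : l = i
        · subst hli
          have := hrest j hij.symm
          omega
        · by_cases hlj : l = j
          · subst hlj
            have := hrest i hij
            omega
          · have := hrest i (Ne.symm hli)
            have := hrest j (Ne.symm hlj)
            omega
      omega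
    funext m
    rw [diagRefl_apply hij]
    split_ifs with h1 h2
    · subst h1; omega
    · subst h2; omega
    · rfl

end Reflect

/-! ### The monotone walk (Duminil-Copin 2019, eq. (4.10)), abstractly

For a function `T` on `ℤᵈ` invariant under signed coordinate permutations and decreasing under the
axis move `x ↦ x + eᵢ` (`xᵢ ≥ 0`) and the diagonal move `x ↦ x + eᵢ - eⱼ` (`xⱼ ≤ xᵢ`):
`T(d n e₁) ≤ T(y) ≤ T(n e₁)` for `‖y‖_∞ = n`, whence `T(y) ≤ T(x)` for `‖y‖_∞ ≥ d ‖x‖_∞`. The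
proofs follow `MessagerMiracleSoleFree` (Ising free state) line by line. -/

section MonotoneWalk

variable {d}
variable (T : Site d → ℝ)

/-- Coordinate permutations leave `T` invariant. [cite: FriedliVelenik2017, Exercise 3.14, p. 115] -/
theorem walk_perm
    (hperm : ∀ (π : Equiv.Perm (Fin d)) (ε : Fin d → ℤˣ) (x : Site d), T (Site.signedPerm π ε x) = T x)
    (π : Equiv.Perm (Fin d)) (x : Site d) : T (fun i => x (π i)) = T x := by
  have h : (fun i => x (π i)) = Site.signedPerm π.symm 1 x := by
    funext i
    simp
  rw [h, hperm]

/-- Coordinate reflections leave `T` invariant. [cite: FriedliVelenik2017, Exercise 3.14, p. 115] -/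
theorem walk_reflection
    (hperm : ∀ (π : Equiv.Perm (Fin d)) (ε : Fin d → ℤˣ) (x : Site d), T (Site.signedPerm π ε x) = T x)
    (j : Fin d) (x : Site d) : T (Function.update x j (-x j)) = T x := by
  classical
  have h : Function.update x j (-x j) =
      Site.signedPerm (Equiv.refl _) (Function.update 1 j (-1)) x := by
    funext i
    by_cases hij : i = j
    · subst hij
      simp
    · simp [hij]
  rw [h, hperm]

/-- Iterating the axis move: `T(x + m eᵢ) ≤ T(x)` for `xᵢ ≥ 0`, `m ∈ ℕ`. [cite: DuminilCopin2019, Exercise 37 (3)–(4), §4.3] -/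
theorem walk_add_single_le
    (haxis : ∀ (x : Site d) (i : Fin d), 0 ≤ x i → T (x + Pi.single i 1) ≤ T x)
    (x : Site d) (i : Fin d) (hx : 0 ≤ x i) (m : ℕ) :
    T (x + Pi.single i (m : ℤ)) ≤ T x := by
  induction m with
  | zero => simp
  | succ m ih =>
      have h := haxis (x + Pi.single i (m : ℤ)) i (by simp; omega)
      have heq : x + Pi.single i (m : ℤ) + Pi.single i 1 =
          x + Pi.single i (((m + 1 : ℕ) : ℤ)) := by
        rw [add_assoc, ← Pi.single_add]
        push_cast
        rfl
      rw [heq] at h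
      exact h.trans ih

/-- Zeroing a set of coordinates of a site with nonnegative coordinates increases `T`. [cite: DuminilCopin2019, Exercise 37 (4), §4.3] -/
theorem walk_le_zero_coords
    (haxis : ∀ (x : Site d) (i : Fin d), 0 ≤ x i → T (x + Pi.single i 1) ≤ T x)
    (z : Site d) (hz : ∀ i, 0 ≤ z i) (S : Finset (Fin d)) :
    T z ≤ T (fun i => if i ∈ S then 0 else z i) := by
  classical
  induction S using Finset.induction_on with
  | empty => simp
  | insert j S hjS ih =>
      refine ih.trans ?_
      have key := walk_add_single_le T haxis
        (fun i => if i ∈ insert j S then 0 else z i) j (by simp) (z j).toNat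
      have heq : ((fun i => if i ∈ insert j S then (0 : ℤ) else z i) +
          Pi.single j (((z j).toNat : ℕ) : ℤ)) = fun i => if i ∈ S then 0 else z i := by
        funext i
        rw [Int.toNat_of_nonneg (hz j)]
        by_cases hij : i = j
        · subst hij
          simp [hjS]
        · simp [hij, Finset.mem_insert]
      rw [heq] at key
      exact key

/-- `T(z) ≤ T(z_{i₀} e_{i₀})` for `z ≥ 0`. [cite: DuminilCopin2019, Exercise 37 (4), §4.3] -/
theorem walk_le_single_of_nonneg
    (haxis : ∀ (x : Site d) (i : Fin d), 0 ≤ x i → T (x + Pi.single i 1) ≤ T x)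
    (z : Site d) (hz : ∀ i, 0 ≤ z i) (i₀ : Fin d) :
    T z ≤ T (Pi.single i₀ (z i₀)) := by
  classical
  have h := walk_le_zero_coords T haxis z hz (univ.erase i₀)
  have heq : (fun i => if i ∈ univ.erase i₀ then (0 : ℤ) else z i) = Pi.single i₀ (z i₀) := by
    funext i
    by_cases hi : i = i₀
    · subst hi
      simp
    · simp [hi]
  rwa [heq] at h

/-- `T(|y|) = T(y)` with `|y| = (|y₁|,…,|y_d|)`. [cite: FriedliVelenik2017, Exercise 3.14] -/
theorem walk_abs_eq
    (hperm : ∀ (π : Equiv.Perm (Fin d)) (ε : Fin d → ℤˣ) (x : Site d), T (Site.signedPerm π ε x) = T x)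
    (y : Site d) : T (fun i => |y i|) = T y := by
  classical
  suffices h : ∀ S : Finset (Fin d), T (fun i => if i ∈ S then |y i| else y i) = T y by
    simpa using h univ
  intro S
  induction S using Finset.induction_on with
  | empty => simp
  | insert j S hjS ih =>
      rw [← ih]
      by_cases hyj : 0 ≤ y j
      · congr 1
        funext i
        by_cases hij : i = j
        · subst hij
          simp [abs_of_nonneg hyj]
        · simp [Finset.mem_insert, hij]
      · rw [← walk_reflection T hperm j (fun i => if i ∈ S then |y i| else y i)]
        congr 1
        funext i
        by_cases hij : i = j
        · subst hij
          simp [hjS, abs_of_neg (not_le.1 hyj)]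
        · simp [Finset.mem_insert, hij]

/-- `T(a e_{i₀}) = T(a e_{i₁})`. [cite: FriedliVelenik2017, Exercise 3.14] -/
theorem walk_single_eq_single
    (hperm : ∀ (π : Equiv.Perm (Fin d)) (ε : Fin d → ℤˣ) (x : Site d), T (Site.signedPerm π ε x) = T x)
    (i₀ i₁ : Fin d) (a : ℤ) : T (Pi.single i₀ a) = T (Pi.single i₁ a) := by
  classical
  have h := walk_perm T hperm (Equiv.swap i₁ i₀) (Pi.single i₀ a)
  have heq : (fun i => (Pi.single i₀ a : Site d) (Equiv.swap i₁ i₀ i)) = Pi.single i₁ a := by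
    funext i
    by_cases hi : i = i₁
    · subst hi
      simp
    · by_cases hi' : i = i₀
      · subst hi'
        rw [Equiv.swap_apply_right]
        simp [hi, Ne.symm hi]
      · rw [Equiv.swap_apply_of_ne_of_ne hi hi']
        simp [hi, hi']
  rw [heq] at h
  exact h.symm

/-- **Left half of (4.10)**: `T(y) ≤ T(n e₁)` for `‖y‖_∞ = n` (`d ≥ 1`). [cite: DuminilCopin2019, Exercise 37 (4), eq. (4.10), §4.3] -/
theorem walk_le_axis_of_supNorm_eq
    (hperm : ∀ (π : Equiv.Perm (Fin d)) (ε : Fin d → ℤˣ) (x : Site d), T (Site.signedPerm π ε x) = T x)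
    (haxis : ∀ (x : Site d) (i : Fin d), 0 ≤ x i → T (x + Pi.single i 1) ≤ T x)
    (hd : 1 ≤ d) {n : ℕ} {y : Site d} (hy : Site.supNorm y = n) :
    T y ≤ T (Pi.single (⟨0, hd⟩ : Fin d) (n : ℤ)) := by
  obtain ⟨i₀, hi₀⟩ := Site.exists_natAbs_eq_supNorm ⟨⟨0, hd⟩, mem_univ _⟩ y
  rw [← walk_abs_eq T hperm y]
  refine (walk_le_single_of_nonneg T haxis _ (fun i => abs_nonneg _) i₀).trans ?_
  have habs : |y i₀| = (n : ℤ) := by rw [Int.abs_eq_natAbs, hi₀, hy]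
  change T (Pi.single i₀ |y i₀|) ≤ _
  rw [habs, walk_single_eq_single T hperm i₀ ⟨0, hd⟩]

/-- Collapsing the mass of a site onto its largest coordinate with the diagonal move: if
`0 ≤ x_j ≤ x_{i₀}` for all `j ≠ i₀`, then `T((∑ᵢ xᵢ) e_{i₀}) ≤ T(x)`. [cite: DuminilCopin2019, Exercise 37 (4), §4.3] -/
theorem walk_single_sum_le
    (hdiag : ∀ (x : Site d) (i j : Fin d), i ≠ j → x j ≤ x i →
      T (x + Pi.single i 1 - Pi.single j 1) ≤ T x)
    (i₀ : Fin d) :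
    ∀ (M : ℕ) (x : Site d), (∀ j, j ≠ i₀ → 0 ≤ x j ∧ x j ≤ x i₀) →
      ∑ j ∈ univ.erase i₀, x j = M → T (Pi.single i₀ (∑ i, x i)) ≤ T x := by
  classical
  intro M
  induction M with
  | zero =>
      intro x hx hsum
      have hzero : ∀ j ∈ univ.erase i₀, x j = 0 :=
        (Finset.sum_eq_zero_iff_of_nonneg fun j hj =>
          (hx j (Finset.ne_of_mem_erase hj)).1).1 (by exact_mod_cast hsum)
      have hxeq : Pi.single i₀ (x i₀) = x := by
        funext j
        by_cases hj : j = i₀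
        · subst hj
          simp
        · rw [Pi.single_eq_of_ne hj]
          exact (hzero j (mem_erase.2 ⟨hj, mem_univ _⟩)).symm
      have hs : ∑ i, x i = x i₀ := by
        rw [← Finset.add_sum_erase _ _ (mem_univ i₀), Finset.sum_eq_zero hzero, add_zero]
      rw [hs, hxeq]
  | succ M ih =>
      intro x hx hsum
      obtain ⟨j, hj, hxj⟩ : ∃ j ∈ univ.erase i₀, 0 < x j := by
        by_contra hcon
        push Not at hcon
        have hle : ∑ j ∈ univ.erase i₀, x j ≤ 0 := Finset.sum_nonpos hcon
        push_cast at hsum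
        omega
      have hji : j ≠ i₀ := Finset.ne_of_mem_erase hj
      set x' : Site d := x + Pi.single i₀ 1 - Pi.single j 1 with hx'
      have hstep := hdiag x i₀ j (Ne.symm hji) (hx j hji).2
      refine le_trans ?_ hstep
      have hx'i0 : x' i₀ = x i₀ + 1 := by simp [hx', Ne.symm hji]
      have hx'j : x' j = x j - 1 := by simp [hx', hji]
      have hx'k : ∀ k, k ≠ i₀ → k ≠ j → x' k = x k := by
        intro k hk hkj
        simp [hx', hk, hkj]
      have hcond : ∀ k, k ≠ i₀ → 0 ≤ x' k ∧ x' k ≤ x' i₀ := by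
        intro k hk
        by_cases hkj : k = j
        · subst hkj
          rw [hx'j, hx'i0]
          have := (hx k hk).2
          constructor <;> omega
        · rw [hx'k k hk hkj, hx'i0]
          have := hx k hk
          constructor <;> omega
      have hsum' : ∑ k ∈ univ.erase i₀, x' k = M := by
        have h1 : ∑ k ∈ univ.erase i₀, x' k + 1 = ∑ k ∈ univ.erase i₀, x k := by
          rw [← Finset.add_sum_erase _ _ hj, ← Finset.add_sum_erase (univ.erase i₀) x hj, hx'j,
            Finset.sum_congr rfl fun k hk => hx'k k (Finset.ne_of_mem_erase (mem_of_mem_erase hk))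
              (Finset.ne_of_mem_erase hk)]
          ring
        push_cast at hsum
        omega
      have htot : ∑ i, x' i = ∑ i, x i := by
        simp only [hx', Pi.sub_apply, Pi.add_apply, Finset.sum_sub_distrib,
          Finset.sum_add_distrib, Finset.sum_pi_single', mem_univ, if_true]
        ring
      rw [← htot]
      exact ih x' hcond hsum'

/-- **Right half of (4.10)**: `T(d n e₁) ≤ T(y)` for `‖y‖_∞ = n` (`d ≥ 1`). [cite: DuminilCopin2019, Exercise 37 (4), eq. (4.10), §4.3] -/
theorem walk_mul_axis_le_of_supNorm_eq
    (hperm : ∀ (π : Equiv.Perm (Fin d)) (ε : Fin d → ℤˣ) (x : Site d), T (Site.signedPerm π ε x) = T x)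
    (haxis : ∀ (x : Site d) (i : Fin d), 0 ≤ x i → T (x + Pi.single i 1) ≤ T x)
    (hdiag : ∀ (x : Site d) (i j : Fin d), i ≠ j → x j ≤ x i →
      T (x + Pi.single i 1 - Pi.single j 1) ≤ T x)
    (hd : 1 ≤ d) {n : ℕ} {y : Site d} (hy : Site.supNorm y = n) :
    T (Pi.single (⟨0, hd⟩ : Fin d) ((d : ℤ) * n)) ≤ T y := by
  obtain ⟨i₀, hi₀⟩ := Site.exists_natAbs_eq_supNorm ⟨⟨0, hd⟩, mem_univ _⟩ y
  set z : Site d := fun i => |y i| with hz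
  have hz0 : ∀ i, 0 ≤ z i := fun i => abs_nonneg _
  have hzle : ∀ i, z i ≤ n := fun i => by
    have h := Site.natAbs_le_supNorm y i
    rw [hy] at h
    simp only [hz, Int.abs_eq_natAbs]
    exact_mod_cast h
  have hzi0 : z i₀ = n := by
    change |y i₀| = (n : ℤ)
    rw [Int.abs_eq_natAbs, hi₀, hy]
  rw [← walk_abs_eq T hperm y, walk_single_eq_single T hperm ⟨0, hd⟩ i₀]
  change T (Pi.single i₀ ((d : ℤ) * n)) ≤ T z
  set s : ℤ := ∑ i, z i with hs
  have hs_le : s ≤ (d : ℤ) * n := by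
    calc s = ∑ i, z i := rfl
      _ ≤ ∑ _i : Fin d, (n : ℤ) := Finset.sum_le_sum fun i _ => hzle i
      _ = d * n := by simp
  have hs_ge : (n : ℤ) ≤ s := by
    rw [← hzi0]
    exact Finset.single_le_sum (fun i _ => hz0 i) (mem_univ i₀)
  have h1 : T (Pi.single i₀ s) ≤ T z :=
    walk_single_sum_le T hdiag i₀ (∑ j ∈ univ.erase i₀, z j).toNat z
      (fun j _ => ⟨hz0 j, (hzle j).trans hzi0.ge⟩)
      (by rw [Int.toNat_of_nonneg (Finset.sum_nonneg fun j _ => hz0 j)])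
  have h2 : T (Pi.single i₀ ((d : ℤ) * n)) ≤ T (Pi.single i₀ s) := by
    have h := walk_add_single_le T haxis (Pi.single i₀ s) i₀ (by simp; omega) ((d : ℤ) * n - s).toNat
    rwa [← Pi.single_add, Int.toNat_of_nonneg (by omega), add_sub_cancel] at h
  exact h2.trans h1

/-- Along the first axis `T` is non-increasing: `T(n e₁) ≤ T(m e₁)` for `m ≤ n`. [cite: DuminilCopin2019, Exercise 37 (3), §4.3] -/
theorem walk_single_anti
    (haxis : ∀ (x : Site d) (i : Fin d), 0 ≤ x i → T (x + Pi.single i 1) ≤ T x)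
    (hd : 1 ≤ d) {m n : ℕ} (hmn : m ≤ n) :
    T (Pi.single (⟨0, hd⟩ : Fin d) (n : ℤ)) ≤ T (Pi.single (⟨0, hd⟩ : Fin d) (m : ℤ)) := by
  have h := walk_add_single_le T haxis (Pi.single (⟨0, hd⟩ : Fin d) (m : ℤ)) ⟨0, hd⟩
    (by simp) (n - m)
  rwa [← Pi.single_add, show ((m : ℤ) + ((n - m : ℕ) : ℤ)) = n by omega] at h

/-- **Aizenman–Duminil-Copin's (5.21), abstractly**: `T(y) ≤ T(x)` whenever `‖y‖_∞ ≥ d ‖x‖_∞`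
("since `‖x‖₁ ≤ d‖x‖_∞ ≤ ‖y‖_∞`, by (5.20) the two quantities are on the correspondingly opposite
sides of `T((‖x‖₁, 0_⊥))`"). [cite: AizenmanDuminilCopinAnnals2021, (5.21) (p. 16)] -/
theorem walk_le_of_mul_supNorm_le
    (hperm : ∀ (π : Equiv.Perm (Fin d)) (ε : Fin d → ℤˣ) (x : Site d), T (Site.signedPerm π ε x) = T x)
    (haxis : ∀ (x : Site d) (i : Fin d), 0 ≤ x i → T (x + Pi.single i 1) ≤ T x)
    (hdiag : ∀ (x : Site d) (i j : Fin d), i ≠ j → x j ≤ x i →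
      T (x + Pi.single i 1 - Pi.single j 1) ≤ T x)
    (hd : 1 ≤ d) {x y : Site d} (hxy : d * Site.supNorm x ≤ Site.supNorm y) : T y ≤ T x := by
  calc T y ≤ T (Pi.single (⟨0, hd⟩ : Fin d) (Site.supNorm y : ℤ)) :=
        walk_le_axis_of_supNorm_eq T hperm haxis hd rfl
    _ ≤ T (Pi.single (⟨0, hd⟩ : Fin d) ((d * Site.supNorm x : ℕ) : ℤ)) :=
        walk_single_anti T haxis hd hxy
    _ = T (Pi.single (⟨0, hd⟩ : Fin d) ((d : ℤ) * Site.supNorm x)) := by rw [Nat.cast_mul]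
    _ ≤ T x := walk_mul_axis_le_of_supNorm_eq T hperm haxis hdiag hd rfl

end MonotoneWalk

/-! ### (5.21) for the lattice `φ⁴` two-point function -/

section Phi4Walk

/-- **Aizenman–Duminil-Copin (5.21) for the free-boundary lattice `φ⁴` model on `ℤᵈ`** (`d ≥ 1`,
`g > 0`, `J ≥ 0`): with `S(x) = ⨆_Λ ⟨φ₀ φₓ⟩_{Λ; g,κ,J}` (`= phi4TwoPoint d g κ J x`),
`S(y) ≤ S(x)` whenever `‖y‖_∞ ≥ d ‖x‖_∞` — from the MMS monotonicity Prop. 5.1 (the axis and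
diagonal moves `phi4_mms_axis`, `phi4_mms_diag`) and the hyperoctahedral symmetry. [cite: AizenmanDuminilCopinAnnals2021, Prop. 5.1 and (5.21) (p. 16)] -/
theorem phi4_iSup_le_of_mul_supNorm_le (hd : 1 ≤ d) {g : ℝ} (hg : 0 < g) (κ : ℝ) {J : ℝ}
    (hJ : 0 ≤ J) {x y : Site d} (hxy : d * Site.supNorm x ≤ Site.supNorm y) :
    (⨆ Λ : Finset (Site d), phi4TwoPointIn d Λ g κ J 0 y) ≤
      ⨆ Λ : Finset (Site d), phi4TwoPointIn d Λ g κ J 0 x :=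
  walk_le_of_mul_supNorm_le (fun z => ⨆ Λ : Finset (Site d), phi4TwoPointIn d Λ g κ J 0 z)
    (fun π ε z => iSup_phi4TwoPointIn_signedPerm d π ε g κ J z)
    (fun z i hz => phi4_mms_axis d hg κ hJ z i hz)
    (fun z _ _ hij hz => phi4_mms_diag d hg κ hJ z hij hz) hd hxy

/-- In particular `S(y) ≤ S(0)` for every `y` (`d ≥ 1`). [cite: AizenmanDuminilCopinAnnals2021, (5.21) (p. 16)] -/
theorem phi4_iSup_le_iSup_zero (hd : 1 ≤ d) {g : ℝ} (hg : 0 < g) (κ : ℝ) {J : ℝ} (hJ : 0 ≤ J)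
    (y : Site d) :
    (⨆ Λ : Finset (Site d), phi4TwoPointIn d Λ g κ J 0 y) ≤
      ⨆ Λ : Finset (Site d), phi4TwoPointIn d Λ g κ J 0 0 :=
  phi4_iSup_le_of_mul_supNorm_le d hd hg κ hJ (by
    rw [Site.supNorm_eq_zero_iff.2 rfl, mul_zero]; exact Nat.zero_le _)

/-- `(5.21)` for the tree's `phi4TwoPoint`: `phi4TwoPoint d g κ J y ≤ phi4TwoPoint d g κ J x` for
`‖y‖_∞ ≥ d ‖x‖_∞`. [cite: AizenmanDuminilCopinAnnals2021, (5.21) (p. 16)] -/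
theorem phi4TwoPoint_le_of_mul_supNorm_le (hd : 1 ≤ d) {g : ℝ} (hg : 0 < g) (κ : ℝ) {J : ℝ}
    (hJ : 0 ≤ J) {x y : Site d} (hxy : d * Site.supNorm x ≤ Site.supNorm y) :
    phi4TwoPoint d g κ J y ≤ phi4TwoPoint d g κ J x := by
  rw [phi4TwoPoint_eq_iSup d hg κ hJ, phi4TwoPoint_eq_iSup d hg κ hJ]
  exact phi4_iSup_le_of_mul_supNorm_le d hd hg κ hJ hxy

end Phi4Walk

end Literature.MathematicalPhysics.QuantumLattice
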